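import Summits.FinalStateConjecture.FinalStateConjecture.Theorems.EIHFluxBalanceInertialRecessionStubWindowChargesStokes
import Summits.FinalStateConjecture.FinalStateConjecture.Theorems.EIHFluxBalanceInertialRecessionStubWindowChargesMoving

/-!
# Window charges (stub `stub_windowCharges`): the transport theorem for moving coordinate spheres

Helper file for the line `sublinear-is-free-clean-window-charges` of the crux `InertialRecession`
(item `stmt-FinalStateConjecture-10166`), stub `stub_windowCharges`.

`transport_identity` — **the transport theorem** for the Landau–Lifshitz momentum flux through a
MOVING coordinate sphere (LL §96, (96.10)–(96.12)): for `g` smooth and nondegenerate on an open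
`W ⊆ E4` containing the sphere `{(t, ξ + ρα)}`, centre velocity `a` and radial speed `r`,
`2ρr ∫ Σ_j h^{μ0j} α_j dτ + ρ² ∫ Σ_j Dh^{μ0j}(1, a + rα) α_j dτ
  = ρ² ∫ [(r + a·α) emComplex^{μ0} − Σ_j emComplex^{μj} α_j] dτ`,
i.e. `dP/dt = −∮ (−g)(T+t)^{μj} n_j dσ + ∮ (−g)(T+t)^{μ0} (V·n) dσ` with the normal velocity
`V·n = Ṙ + ċ·n`. Pointwise, `∂₀h^{μ0j} = −emComplex^{μj} + Σ_k ∂_k h^{μjk}` and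
`Σ_k ∂_k h^{μ0k} = emComplex^{μ0}` (file `…Pointwise`), and ALL remaining terms — the flux of the
antisymmetric `h^{μjk}`, the difference `∮ ∂_a F·n − ∮ (div F)(a·n)` and the radial transport term
`2ρ⁻¹∮ F·n + ∮ (∂_n F)·n − ∮ div F` — form the flux of ONE antisymmetric matrix field
`ρ² h^{μjk} + ρ²(F_j a_k − F_k a_j) + ρ r (F_j z_k − F_k z_j)` through the closed sphere, which
vanishes (file `…Stokes`); the algebra is `transport_pointwise_algebra` (file `…Moving`).
-/

noncomputable section

-- instance search on the nested operator spaces `E4 →L[ℝ] E4 →L[ℝ] ℝ` is deep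
set_option maxSynthPendingDepth 3

open Set Filter Metric MeasureTheory MeasureTheory.Measure
open scoped Topology

namespace Summit.FinalStateConjecture.FinalStateConjecture.Theorems.SublinearIsFree.WindowCharges

open Literature.Geometry.Lorentzian Literature.Geometry.Lorentzian.LandauLifshitz

/-! ### Regularity of the Landau–Lifshitz fields along slices -/

/-- The energy–momentum complex is continuous where the components are `C^∞` and nondegenerate.
[cite: LandauLifshitz1975, §96 (96.5)] -/
theorem continuousOn_emComplex {g : E4 → E4 →L[ℝ] E4 →L[ℝ] ℝ} {W : Set E4} (hW : IsOpen W)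
    (hg : ContDiffOn ℝ (⊤ : ℕ∞) g W) (hdet : ∀ x ∈ W, metricDet g x ≠ 0) (μ ν : Fin 4) :
    ContinuousOn (fun x ↦ emComplex g x μ ν) W := by
  have h : ∀ α : Fin 4, ContinuousOn (fun x ↦ partialDeriv α (fun y ↦ hField g y μ ν α) x) W :=
    fun α ↦ (LLBalance.contDiffOn_partialDeriv hW (LLBalance.contDiffOn_hField hW hg hdet μ ν α)
      α).continuousOn
  unfold emComplex
  exact continuousOn_finsetSum _ fun α _ ↦ h α

/-- Points `ρ α` (`α` a unit vector) lie on the sphere of radius `ρ ≥ 0`. [folklore] -/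
theorem smul_coe_mem_sphere {ρ : ℝ} (hρ : 0 ≤ ρ) (α : sphere (0 : E3) 1) :
    ρ • (α : E3) ∈ sphere (0 : E3) ρ := by
  rw [mem_sphere_zero_iff_norm, norm_smul, norm_coe_unitSphere, mul_one, Real.norm_of_nonneg hρ]

/-- Every point of the sphere of radius `ρ > 0` is `ρ α` for a unit vector `α`. [folklore] -/
theorem exists_eq_smul_coe_of_mem_sphere {ρ : ℝ} (hρ : 0 < ρ) {z : E3} (hz : z ∈ sphere (0 : E3) ρ) :
    ∃ α : sphere (0 : E3) 1, z = ρ • (α : E3) := by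
  have hzn : ‖z‖ = ρ := mem_sphere_zero_iff_norm.1 hz
  refine ⟨⟨ρ⁻¹ • z, ?_⟩, ?_⟩
  · rw [mem_sphere_zero_iff_norm, norm_smul, norm_inv, Real.norm_of_nonneg hρ.le, hzn,
      inv_mul_cancel₀ hρ.ne']
  · simp [smul_smul, mul_inv_cancel₀ hρ.ne']

/-- The sum of the squared coordinates of a unit vector is one. [folklore] -/
theorem sum_sq_coe_unitSphere (α : sphere (0 : E3) 1) : ∑ k : Fin 3, (α : E3) k ^ 2 = 1 := by
  have h := EuclideanSpace.norm_sq_eq (α : E3)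
  rw [norm_coe_unitSphere, one_pow] at h
  simp only [Real.norm_eq_abs, sq_abs] at h
  exact h.symm

/-! ### The transport identity -/

/-- **Transport theorem for the Landau–Lifshitz momentum flux through a moving coordinate sphere**
(LL §96, (96.10)–(96.12), moving-surface form). Let `g` be `C^∞` and nondegenerate on the open
`W ⊆ E4`, and let the coordinate sphere `{(t, ξ + ρα)}` (`ρ > 0`) lie in `W`. For every centre
velocity `a ∈ E3` and radial speed `r`,
`2ρr ∫ Σ_j h^{μ0j} α_j dτ + ρ² ∫ Σ_j Dh^{μ0j}(1, a + rα) α_j dτ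
  = ρ² ∫ [(r + a·α) emComplex^{μ0} − Σ_j emComplex^{μj} α_j] dτ`,
all fields evaluated at `(t, ξ + ρα)`. The left side is `d/dt (R² ∫ Σ_j h^{μ0j}(t, c + Rα) α_j dτ)`
at `ξ = c(t)`, `ρ = R(t)`, `a = ċ`, `r = Ṙ` (`hasDerivAt_integral_moving`); the right side is
`−∮ emComplex^{μj} n_j + ∮ emComplex^{μ0} (V·n)` over the unit sphere. Proof:
`transport_pointwise_algebra` pointwise, and the flux of the antisymmetric field
`ρ² h^{μjk} + ρ²(F_j a_k − F_k a_j) + ρ r (F_j z_k − F_k z_j)` (`F_j = h^{μ0j}(t, ξ + ·)`) through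
the sphere vanishes (`toSphere_integral_sum_fderiv_antisymm_eq_zero`).
[cite: LandauLifshitz1975, §96 (96.12)] -/
theorem transport_identity' {g : E4 → E4 →L[ℝ] E4 →L[ℝ] ℝ} {W : Set E4} (hW : IsOpen W)
    (hg : ContDiffOn ℝ (⊤ : ℕ∞) g W) (hdet : ∀ x ∈ W, metricDet g x ≠ 0) {t : ℝ} {ξ : E3}
    {ρ : ℝ} (hρ : 0 < ρ) (hmem : ∀ α : sphere (0 : E3) 1, E4.ofTimeSpace t (ξ + ρ • (α : E3)) ∈ W)
    (a : E3) (r : ℝ) (μ : Fin 4) :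
    2 * ρ * r * (∫ α : sphere (0 : E3) 1, ∑ j : Fin 3,
        hField g (E4.ofTimeSpace t (ξ + ρ • (α : E3))) μ 0 j.succ * (α : E3) j
          ∂(volume : Measure E3).toSphere) +
      ρ ^ 2 * (∫ α : sphere (0 : E3) 1, ∑ j : Fin 3,
        fderiv ℝ (fun x ↦ hField g x μ 0 j.succ) (E4.ofTimeSpace t (ξ + ρ • (α : E3)))
          (E4.ofTimeSpace 1 (a + r • (α : E3))) * (α : E3) j ∂(volume : Measure E3).toSphere) =
      ρ ^ 2 * ∫ α : sphere (0 : E3) 1,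
        ((r + ∑ k : Fin 3, a k * (α : E3) k) *
            emComplex g (E4.ofTimeSpace t (ξ + ρ • (α : E3))) μ 0 -
          ∑ j : Fin 3, emComplex g (E4.ofTimeSpace t (ξ + ρ • (α : E3))) μ j.succ * (α : E3) j)
          ∂(volume : Measure E3).toSphere := by
  -- the fields and their slices
  set H : Fin 3 → E4 → ℝ := fun j y ↦ hField g y μ 0 j.succ with hH
  set B : Fin 3 → Fin 3 → E4 → ℝ := fun j k y ↦ hField g y μ j.succ k.succ with hB
  have hHs : ∀ j, ContDiffOn ℝ (⊤ : ℕ∞) (H j) W := fun j ↦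
    LLBalance.contDiffOn_hField hW hg hdet μ 0 j.succ
  have hBs : ∀ j k, ContDiffOn ℝ (⊤ : ℕ∞) (B j k) W := fun j k ↦
    LLBalance.contDiffOn_hField hW hg hdet μ j.succ k.succ
  set sl : E3 → E4 := fun z ↦ E4.ofTimeSpace t (ξ + z) with hsl
  have hslc : ContDiff ℝ (⊤ : ℕ∞) sl := contDiff_slice t ξ
  set U : Set E3 := sl ⁻¹' W with hU
  have hUo : IsOpen U := hW.preimage hslc.continuous
  have hsub : sphere (0 : E3) ρ ⊆ U := by
    intro z hz
    obtain ⟨α, rfl⟩ := exists_eq_smul_coe_of_mem_sphere hρ hz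
    exact hmem α
  have hzU : ∀ α : sphere (0 : E3) 1, ρ • (α : E3) ∈ U := fun α ↦ hsub (smul_coe_mem_sphere hρ.le α)
  set Fs : Fin 3 → E3 → ℝ := fun j z ↦ H j (sl z) with hFs
  set Bs : Fin 3 → Fin 3 → E3 → ℝ := fun j k z ↦ B j k (sl z) with hBsd
  have hFss : ∀ j, ContDiffOn ℝ (⊤ : ℕ∞) (Fs j) U := fun j ↦
    (hHs j).comp hslc.contDiffOn fun z hz ↦ hz
  have hBss : ∀ j k, ContDiffOn ℝ (⊤ : ℕ∞) (Bs j k) U := fun j k ↦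
    (hBs j k).comp hslc.contDiffOn fun z hz ↦ hz
  have hcoord : ∀ k : Fin 3, ContDiff ℝ (⊤ : ℕ∞) fun z : E3 ↦ z k := fun k ↦
    (EuclideanSpace.proj (𝕜 := ℝ) (ι := Fin 3) k).contDiff
  -- the antisymmetric field
  set A : Fin 3 → Fin 3 → E3 → ℝ := fun j k z ↦ ρ ^ 2 * Bs j k z +
    ρ ^ 2 * (Fs j z * a k - Fs k z * a j) + ρ * r * (Fs j z * z k - Fs k z * z j) with hA
  have hA2 : ∀ j k, ContDiffOn ℝ 2 (A j k) U := by
    intro j k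
    have h2 : (2 : WithTop ℕ∞) ≤ (⊤ : ℕ∞) := WithTop.coe_le_coe.mpr le_top
    refine ((contDiffOn_const.mul ((hBss j k).of_le h2)).add (contDiffOn_const.mul
      ((((hFss j).of_le h2).mul contDiffOn_const).sub (((hFss k).of_le h2).mul
        contDiffOn_const)))).add (contDiffOn_const.mul ((((hFss j).of_le h2).mul
          ((hcoord k).of_le h2).contDiffOn).sub (((hFss k).of_le h2).mul
            ((hcoord j).of_le h2).contDiffOn)))
  have hanti : ∀ j k z, A j k z = -A k j z := by
    intro j k z
    have hb : Bs k j z = -Bs j k z := hField_swap g (sl z) μ j.succ k.succ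
    simp only [hA, hb]
    ring
  have hStokes := toSphere_integral_sum_fderiv_antisymm_eq_zero' hUo hρ hsub hA2 hanti
  -- differentiability at the points of the sphere
  have hne : ((⊤ : ℕ∞) : WithTop ℕ∞) ≠ 0 := by simp
  have hHd : ∀ j (α : sphere (0 : E3) 1), DifferentiableAt ℝ (H j) (sl (ρ • (α : E3))) :=
    fun j α ↦ ((hHs j).differentiableOn hne).differentiableAt (hW.mem_nhds (hmem α))
  have hBd : ∀ j k (α : sphere (0 : E3) 1), DifferentiableAt ℝ (B j k) (sl (ρ • (α : E3))) :=
    fun j k α ↦ ((hBs j k).differentiableOn hne).differentiableAt (hW.mem_nhds (hmem α))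
  have hFsd : ∀ j (α : sphere (0 : E3) 1), DifferentiableAt ℝ (Fs j) (ρ • (α : E3)) :=
    fun j α ↦ ((hFss j).differentiableOn hne).differentiableAt (hUo.mem_nhds (hzU α))
  have hBsd' : ∀ j k (α : sphere (0 : E3) 1), DifferentiableAt ℝ (Bs j k) (ρ • (α : E3)) :=
    fun j k α ↦ ((hBss j k).differentiableOn hne).differentiableAt (hUo.mem_nhds (hzU α))
  -- partial derivatives of the slices
  have hFs1 : ∀ j k (α : sphere (0 : E3) 1), fderiv ℝ (Fs j) (ρ • (α : E3))
      (EuclideanSpace.single k 1) = partialDeriv k.succ (H j) (sl (ρ • (α : E3))) := by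
    intro j k α
    rw [hFs, fderiv_comp_slice_apply (hHd j α), fderiv_apply_ofTimeSpace_zero]
    simp [PiLp.single_apply, Finset.sum_ite_eq']
    rfl
  have hBs1 : ∀ j k m (α : sphere (0 : E3) 1), fderiv ℝ (Bs j k) (ρ • (α : E3))
      (EuclideanSpace.single m 1) = partialDeriv m.succ (B j k) (sl (ρ • (α : E3))) := by
    intro j k m α
    rw [hBsd, fderiv_comp_slice_apply (hBd j k α), fderiv_apply_ofTimeSpace_zero]
    simp [PiLp.single_apply, Finset.sum_ite_eq']
    rfl
  -- the divergence of the antisymmetric field, entry by entry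
  have hderiv : ∀ (α : sphere (0 : E3) 1) (j k : Fin 3),
      fderiv ℝ (A j k) (ρ • (α : E3)) (EuclideanSpace.single k 1) =
        ρ ^ 2 * partialDeriv k.succ (B j k) (sl (ρ • (α : E3))) +
          ρ ^ 2 * (partialDeriv k.succ (H j) (sl (ρ • (α : E3))) * a k -
            partialDeriv k.succ (H k) (sl (ρ • (α : E3))) * a j) +
          ρ * r * (H j (sl (ρ • (α : E3))) + ρ * (α : E3) k *
            partialDeriv k.succ (H j) (sl (ρ • (α : E3))) -
            H k (sl (ρ • (α : E3))) * (if j = k then 1 else 0) -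
            ρ * (α : E3) j * partialDeriv k.succ (H k) (sl (ρ • (α : E3)))) := by
    intro α j k
    have hc : ∀ m : Fin 3, HasFDerivAt (fun z : E3 ↦ (z m : ℝ))
        (EuclideanSpace.proj (𝕜 := ℝ) m : E3 →L[ℝ] ℝ) (ρ • (α : E3)) := fun m ↦
      (EuclideanSpace.proj (𝕜 := ℝ) (ι := Fin 3) m).hasFDerivAt.congr_of_eventuallyEq
        (Eventually.of_forall fun z ↦ rfl)
    have hF : ∀ i, HasFDerivAt (Fs i) (fderiv ℝ (Fs i) (ρ • (α : E3))) (ρ • (α : E3)) :=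
      fun i ↦ (hFsd i α).hasFDerivAt
    have hBk : HasFDerivAt (Bs j k) (fderiv ℝ (Bs j k) (ρ • (α : E3))) (ρ • (α : E3)) :=
      (hBsd' j k α).hasFDerivAt
    have hAd : HasFDerivAt (A j k)
        (ρ ^ 2 • fderiv ℝ (Bs j k) (ρ • (α : E3)) +
          ρ ^ 2 • (a k • fderiv ℝ (Fs j) (ρ • (α : E3)) - a j • fderiv ℝ (Fs k) (ρ • (α : E3))) +
          (ρ * r) • ((Fs j (ρ • (α : E3)) • (EuclideanSpace.proj k : E3 →L[ℝ] ℝ) +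
            (ρ • (α : E3)) k • fderiv ℝ (Fs j) (ρ • (α : E3))) -
            (Fs k (ρ • (α : E3)) • (EuclideanSpace.proj j : E3 →L[ℝ] ℝ) +
              (ρ • (α : E3)) j • fderiv ℝ (Fs k) (ρ • (α : E3))))) (ρ • (α : E3)) :=
      ((hBk.const_mul (ρ ^ 2)).add ((((hF j).mul_const (a k)).sub ((hF k).mul_const
        (a j))).const_mul (ρ ^ 2))).add ((((hF j).mul (hc k)).sub ((hF k).mul (hc j))).const_mul
          (ρ * r))
    rw [hAd.fderiv]
    simp only [_root_.add_apply, _root_.sub_apply, _root_.smul_apply, smul_eq_mul, hFs1, hBs1,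
      PiLp.proj_apply, PiLp.single_apply, PiLp.smul_apply, if_true]
    simp only [hFs]
    ring
  -- the pointwise identity
  have hpt : ∀ α : sphere (0 : E3) 1,
      2 * ρ * r * (∑ j : Fin 3, hField g (sl (ρ • (α : E3))) μ 0 j.succ * (α : E3) j) +
        ρ ^ 2 * (∑ j : Fin 3, fderiv ℝ (fun x ↦ hField g x μ 0 j.succ) (sl (ρ • (α : E3)))
          (E4.ofTimeSpace 1 (a + r • (α : E3))) * (α : E3) j) =
      ρ ^ 2 * ((r + ∑ k : Fin 3, a k * (α : E3) k) * emComplex g (sl (ρ • (α : E3))) μ 0 -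
          ∑ j : Fin 3, emComplex g (sl (ρ • (α : E3))) μ j.succ * (α : E3) j) +
        ∑ i : Fin 3, (∑ j : Fin 3, fderiv ℝ (A i j) (ρ • (α : E3))
          (EuclideanSpace.single j 1)) * (α : E3) i := by
    intro α
    simp_rw [hderiv]
    have h1 : ∀ j : Fin 3, fderiv ℝ (fun x ↦ hField g x μ 0 j.succ) (sl (ρ • (α : E3)))
        (E4.ofTimeSpace 1 (a + r • (α : E3))) = partialDeriv 0 (H j) (sl (ρ • (α : E3))) +
          ∑ k : Fin 3, (a k + r * (α : E3) k) * partialDeriv k.succ (H j) (sl (ρ • (α : E3))) := by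
      intro j
      rw [fderiv_apply_ofTimeSpace_one]
      simp only [hH, PiLp.add_apply, PiLp.smul_apply, smul_eq_mul]
    simp_rw [h1]
    exact transport_pointwise_algebra (fun j ↦ H j (sl (ρ • (α : E3))))
      (fun j ↦ partialDeriv 0 (H j) (sl (ρ • (α : E3))))
      (fun j ↦ emComplex g (sl (ρ • (α : E3))) μ j.succ) (fun k ↦ (α : E3) k) (fun k ↦ a k)
      (fun j k ↦ partialDeriv k.succ (H j) (sl (ρ • (α : E3))))
      (fun j k ↦ partialDeriv k.succ (B j k) (sl (ρ • (α : E3))))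
      (emComplex g (sl (ρ • (α : E3))) μ 0) ρ r (emComplex_zero_eq_sum_partialDeriv _ μ)
      (fun j ↦ partialDeriv_zero_hField_eq _ μ j) (sum_sq_coe_unitSphere α)
  -- integrability of the three continuous integrands
  have hslz : Continuous fun α : sphere (0 : E3) 1 ↦ sl (ρ • (α : E3)) :=
    hslc.continuous.comp ((continuous_const (y := ρ)).fun_smul continuous_subtype_val)
  have hI1 : Integrable (fun α : sphere (0 : E3) 1 ↦ ∑ j : Fin 3,
      hField g (sl (ρ • (α : E3))) μ 0 j.succ * (α : E3) j) (volume : Measure E3).toSphere := by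
    refine integrable_toSphere_of_continuous (continuous_finsetSum _ fun j _ ↦ ?_)
    exact ((hHs j).continuousOn.comp_continuous hslz fun α ↦ hmem α).mul
      (continuous_coe_unitSphere_apply j)
  have hI2 : Integrable (fun α : sphere (0 : E3) 1 ↦ ∑ j : Fin 3,
      fderiv ℝ (fun x ↦ hField g x μ 0 j.succ) (sl (ρ • (α : E3)))
        (E4.ofTimeSpace 1 (a + r • (α : E3))) * (α : E3) j) (volume : Measure E3).toSphere := by
    refine integrable_toSphere_of_continuous (continuous_finsetSum _ fun j _ ↦ ?_)
    refine Continuous.mul ?_ (continuous_coe_unitSphere_apply j)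
    have hv : Continuous fun α : sphere (0 : E3) 1 ↦ E4.ofTimeSpace 1 (a + r • (α : E3)) :=
      (continuous_velocity (c' := fun _ ↦ a) (R' := fun _ ↦ r) continuous_const
        continuous_const).comp (Continuous.prodMk_right (0 : ℝ))
    exact (((hHs j).continuousOn_fderiv_of_isOpen hW (by simp)).comp_continuous hslz
      fun α ↦ hmem α).clm_apply hv
  have hI3 : Integrable (fun α : sphere (0 : E3) 1 ↦
      (r + ∑ k : Fin 3, a k * (α : E3) k) * emComplex g (sl (ρ • (α : E3))) μ 0 -
        ∑ j : Fin 3, emComplex g (sl (ρ • (α : E3))) μ j.succ * (α : E3) j)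
      (volume : Measure E3).toSphere := by
    refine integrable_toSphere_of_continuous ?_
    have he : ∀ ν, Continuous fun α : sphere (0 : E3) 1 ↦ emComplex g (sl (ρ • (α : E3))) μ ν :=
      fun ν ↦ (continuousOn_emComplex hW hg hdet μ ν).comp_continuous hslz fun α ↦ hmem α
    exact ((continuous_const.add (continuous_finsetSum _ fun k _ ↦ continuous_const.mul
      (continuous_coe_unitSphere_apply k))).mul (he 0)).sub
        (continuous_finsetSum _ fun j _ ↦ (he _).mul (continuous_coe_unitSphere_apply j))
  have hIS : Integrable (fun α : sphere (0 : E3) 1 ↦ ∑ i : Fin 3, (∑ j : Fin 3,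
      fderiv ℝ (A i j) (ρ • (α : E3)) (EuclideanSpace.single j 1)) * (α : E3) i)
      (volume : Measure E3).toSphere := by
    refine (((hI1.const_mul (2 * ρ * r)).add (hI2.const_mul (ρ ^ 2))).sub
      (hI3.const_mul (ρ ^ 2))).congr (ae_of_all _ fun α ↦ ?_)
    simp only [Pi.add_apply, Pi.sub_apply]
    rw [hpt α]
    ring
  -- conclusion
  calc 2 * ρ * r * (∫ α : sphere (0 : E3) 1, ∑ j : Fin 3,
        hField g (sl (ρ • (α : E3))) μ 0 j.succ * (α : E3) j ∂(volume : Measure E3).toSphere) +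
      ρ ^ 2 * (∫ α : sphere (0 : E3) 1, ∑ j : Fin 3,
        fderiv ℝ (fun x ↦ hField g x μ 0 j.succ) (sl (ρ • (α : E3)))
          (E4.ofTimeSpace 1 (a + r • (α : E3))) * (α : E3) j ∂(volume : Measure E3).toSphere)
      = ∫ α : sphere (0 : E3) 1, (2 * ρ * r * (∑ j : Fin 3,
          hField g (sl (ρ • (α : E3))) μ 0 j.succ * (α : E3) j) +
        ρ ^ 2 * (∑ j : Fin 3, fderiv ℝ (fun x ↦ hField g x μ 0 j.succ) (sl (ρ • (α : E3)))
          (E4.ofTimeSpace 1 (a + r • (α : E3))) * (α : E3) j)) ∂(volume : Measure E3).toSphere := by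
        rw [integral_add (hI1.const_mul _) (hI2.const_mul _), integral_const_mul,
          integral_const_mul]
    _ = ∫ α : sphere (0 : E3) 1, (ρ ^ 2 * ((r + ∑ k : Fin 3, a k * (α : E3) k) *
          emComplex g (sl (ρ • (α : E3))) μ 0 -
          ∑ j : Fin 3, emComplex g (sl (ρ • (α : E3))) μ j.succ * (α : E3) j) +
        ∑ i : Fin 3, (∑ j : Fin 3, fderiv ℝ (A i j) (ρ • (α : E3))
          (EuclideanSpace.single j 1)) * (α : E3) i) ∂(volume : Measure E3).toSphere :=
        integral_congr_ae (ae_of_all _ fun α ↦ hpt α)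
    _ = ρ ^ 2 * ∫ α : sphere (0 : E3) 1,
        ((r + ∑ k : Fin 3, a k * (α : E3) k) * emComplex g (sl (ρ • (α : E3))) μ 0 -
          ∑ j : Fin 3, emComplex g (sl (ρ • (α : E3))) μ j.succ * (α : E3) j)
          ∂(volume : Measure E3).toSphere := by
        rw [integral_add (hI3.const_mul _) hIS, integral_const_mul, hStokes, add_zero]

/-- **Transport theorem for the Landau–Lifshitz momentum flux through a moving coordinate sphere**
— the registered sub-goal form (stub `transport_identity` of the crux item) of
`transport_identity'`. [cite: LandauLifshitz1975, §96 (96.12)] -/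
theorem transport_identity : open Literature.Geometry.Lorentzian Literature.Geometry.Lorentzian.LandauLifshitz MeasureTheory Metric in ∀ (g : E4 → E4 →L[ℝ] E4 →L[ℝ] ℝ) (W : Set E4) (t : ℝ) (ξ : E3) (ρ : ℝ) (a : E3) (r : ℝ) (μ : Fin 4), IsOpen W → ContDiffOn ℝ (⊤ : ℕ∞) g W → (∀ x ∈ W, metricDet g x ≠ 0) → 0 < ρ → (∀ α : sphere (0 : E3) 1, E4.ofTimeSpace t (ξ + ρ • (α : E3)) ∈ W) → 2 * ρ * r * (∫ α : sphere (0 : E3) 1, ∑ j : Fin 3, hField g (E4.ofTimeSpace t (ξ + ρ • (α : E3))) μ 0 j.succ * (α : E3) j ∂(volume : Measure E3).toSphere) + ρ ^ 2 * (∫ α : sphere (0 : E3) 1, ∑ j : Fin 3, fderiv ℝ (fun x ↦ hField g x μ 0 j.succ) (E4.ofTimeSpace t (ξ + ρ • (α : E3))) (E4.ofTimeSpace 1 (a + r • (α : E3))) * (α : E3) j ∂(volume : Measure E3).toSphere) = ρ ^ 2 * ∫ α : sphere (0 : E3) 1, ((r + ∑ k : Fin 3, a k * (α : E3) k) * emComplex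 g (E4.ofTimeSpace t (ξ + ρ • (α : E3))) μ 0 - ∑ j : Fin 3, emComplex g (E4.ofTimeSpace t (ξ + ρ • (α : E3))) μ j.succ * (α : E3) j) ∂(volume : Measure E3).toSphere :=
  fun _ _ _ _ _ a r μ hW hg hdet hρ hmem ↦ transport_identity' hW hg hdet hρ hmem a r μ

end Summit.FinalStateConjecture.FinalStateConjecture.Theorems.SublinearIsFree.WindowCharges

end
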